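import Summits.QuantumFields.YangMills.Theorems.BalabanUVNodesN21GappedRoadN20Invariance
import Summits.QuantumFields.YangMills.Theorems.BalabanUVNodesN21GappedTopPairReading13CoPHDefs
import Summits.QuantumFields.YangMills.Theorems.BalabanUVNodesN21GappedTopPair13CoPHRecord

/-!
# N21 (NE7c) · THE PAIR ROAD COSTS N20 NOTHING BELOW THE TOP: the bad-class sums of dag-n21-w7's DOUBLY-GAPPED class weights `gapWeight2A∕B₁₃ … ρ ρ′ n₁ n₂` are
# DIAL-FREE — `RelWeightBound` at the doubly-gapped carriers does not depend on `(ρ, ρ′, n₁, n₂)`, for every persistence policy cutting strictly below the top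

R134 seat `pub-ymgap-dag-n21-d` (g12, lane owner N21), strategy s2; key K3⁸ `SpineGivenEndpointR13SepCoPHV` = stmt-QuantumFields-27366, `--kind proof --supports 27366 --as helper`;
COUNT-NEUTRAL.  Theorems only (0 `def`).  V2's argument (`…N21GappedRoadN20Invariance`, p631083) for the PAIR-lettered family of dag-n21-w7 g2: imports V2 (§47 `tstepOfRecordAt_mask`,
§48 `keyA₁₃∕keyB₁₃_mem_badClass₁₃_determined`), dag-n21-w7's definition lane `…GappedTopPairReading13CoPHDefs` (`topTerm2AtLevel`, `gapWeight2A∕B₁₃`, `crGap2₁₃VAt`) and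
`…GappedTopPair13CoPHRecord` (`integrable_topPiece2`; through it `…SlotDefs`∕`…Pair13CoPH`: `wTop2At`, `topSlot2At`, `topClassWeight2At`, `isStepUnity_wTop2At`, `measurable_wTop2At`,
`abs_wTop2At_le_one`), all BY NAME.  [III] = [Balaban1988Convergent], [LF-I∕II] = [Balaban1989LargeFieldI∕II].

WHY.  dag-n21-w7's pair reading `crGap2₁₃VAt` re-letters BOTH indicator families of the last 𝐓-step ((3.2) at `θ`, (3.3) at `δ′`); its step weights `wTop2At ϑ θ δ′` resolve unity
against the front factors at the SAME (3.2) letter for EVERY `(θ, δ′)` (`isStepUnity_wTop2At`).  Hence V2's FIBREWISE E1-step holds pair-lettered — `Σ_{s′ : init s′ = s}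
topClassWeight2^{θ,δ′}(s′) = classWeight_k(s)` — and class sums of pair-lettered top terms decided BELOW THE TOP are free of BOTH letters; the persistence class is decided below
the top for `jcut K < K₀ + K ∨ jcut K = 0` (V2 §48), so the bad-class sums and the totals of `gapWeight2A∕B₁₃ … ρ ρ′ n₁ n₂` do not read the four dials, and `RelWeightBound` at
the doubly-gapped carriers is ONE statement for all dials.  (The identification with n20-d's READING OF RECORD — width zero on both grids = the record's post-𝐑 weights by V4's
weight-neutrality of the top 𝐑-step — is the companion `…N21GappedPairRoadRStepNeutral`.)

WHAT IS PROVED (kernel; [bookkeeping]; NO estimate).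
§52 (run-generic, `k + 1 = p.K`) ★★ `sum_fiber_topClassWeight2At_eq` · ★★ `sum_filter_topClassWeight2At_letter_free` · `sum_filter_topTerm2AtLevel_letter_free` (level form, `0 < j` guard).
§53 (at the `CoPH` record; rows `hsel` + (H-ζ)) `sum_keys_gapWeight2A₁₃_eq_sum_filter` ∕ `…B…` (fibre sums over ANY finite key set) · ★★★ `sum_badClass₁₃_gapWeight2A₁₃_letter_free` ∕
  `…B…` · ★ `sum_classSet₁₃_gapWeight2A₁₃_letter_free` ∕ `…B…` (totals) · ★★★ `relWeightBound_gap2Carriers_iff` (∀ W; policies `jcut K < K₀ + K ∨ jcut K = 0`).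

HONEST FRAMING (binding).  Bookkeeping BY NAME over def-T's unity∕RT, node U5d's keys, V2 and dag-n21-w7's objects; NO estimate of Bałaban's; N20's face itself NOT proved (only its
dial-freeness on the pair road); NE7b ∕ NE7c NOT PRINTED for `d = 4`; K0⁷ OPEN; N20 ∕ N21 NOT discharged; K3⁸ NOT claimed; counts UNMOVED (typed 28∕28 · discharged 5∕27); never a
count claim.  No `sorry`, no `def`, no `instance`, no `notation`; standard axioms.  One finite four-torus programme at fixed `ε` — NOT ℝ⁴, NOT OS, NOT a mass gap, NOT the Clay problem.
-/

set_option autoImplicit false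

noncomputable section

open scoped BigOperators
open Finset MeasureTheory

namespace Summit.QuantumFields.YangMills.Theorems.N21ShellSplitOfRecord13CoPH

open Literature.MathematicalPhysics.QuantumFieldTheory.Balaban1983to89
open Literature.MathematicalPhysics.QuantumFieldTheory.Balaban1983to89.T4Continuum
open Literature.MathematicalPhysics.QuantumFieldTheory.Balaban1983to89.Node00
open B14.Eq218Concrete
open YMDAG.UVSplit (SpineReading₁₃CoPH keyA₁₃ keyB₁₃ keyB₁₃_eq runA₁₃ runB₁₃ histA₁₃ histB₁₃ histA₁₃_zero histB₁₃_zero classSet₁₃ badClass₁₃)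
open T4WeightBudget (RelWeightBound)
open Summit.QuantumFields.YangMills.Theorems.N21StepWeightsPositivity (zetaOfRecord_nonneg)
open Summit.QuantumFields.YangMills.BalabanUVNodes.N20KeyedRelWeightSocketAtRecord13CoPH (keyA₁₃_mem_classSet₁₃ keyB₁₃_mem_classSet₁₃)
open Summit.QuantumFields.YangMills.Theorems.N21GappedTopPair13CoPH (wTop2At topSlot2At topClassWeight2At isStepUnity_wTop2At measurable_wTop2At abs_wTop2At_le_one
  integrable_topPiece2 topTerm2AtLevel topTerm2AtLevel_zero topTerm2AtLevel_succ gapWeight2A₁₃ gapWeight2B₁₃ bCutGrid selDepthA2₁₃ selDepthB2₁₃)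

/-! ## §52 Run-generic: the FIBREWISE E1-step and letter-pair-freeness of class sums determined below the top, for the pair-lettered family -/

section Fibre2

variable (F : T4Family) (N : ℕ) [NeZero N] (ϑ : Stage9Params F N) (D : FiniteEpsData F (SU N)) (g₀ : ℕ → ℝ) (os : List (ULoop F))
  (p : B12.RunParams) (g : ℕ → ℝ) (k : ℕ)

/-- ★★ **FIBREWISE E1-STEP FOR THE PAIR-LETTERED TERMS** (`k + 1 = p.K`): for EVERY letter pair `(θ, δ′)` and every level-`k` history `s`,
`Σ_{s′ : init s′ = s} topClassWeight2^{θ,δ′}(s′) = classWeight_k(s)` — def-T's unity of the pair-lettered top 𝐓-step (dag-n21-w7's `isStepUnity_wTop2At`) + the RT identity, on the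
family masked at `s` (V2's `tstepOfRecordAt_mask`).  Rows: (H-ζ), `Σ|ζ| ≤ 1`, `Σζ = 1`, (e1) at level `k`. [bookkeeping] -/
theorem sum_fiber_topClassWeight2At_eq [DecidableEq (SeqOfRecord F ϑ.ν ϑ.τ9.M g p.K k)] (hk : k + 1 = p.K) (hζm : ZetaMeasurable F N ϑ.ζ)
    (hζ1 : IsZetaAbsLeOne F N ϑ.ν ϑ.τ9.M ϑ.ζ) (hζu : IsZetaUnity F N ϑ.ν ϑ.τ9.M ϑ.ζ) (θ δ' t : ℝ)
    (hint : ∀ s : SeqOfRecord F ϑ.ν ϑ.τ9.M g p.K k,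
      Integrable (fun U => chiSeqOfRecord F N ϑ.ν ϑ.τ9.M g p.K k s U * dressedSlotsOfDatum₉ F N ϑ D g₀ os t p g k s U) (fieldMeasure (F.P p.K) k (SU N)))
    (s : SeqOfRecord F ϑ.ν ϑ.τ9.M g p.K k) :
    ∑ s' ∈ univ.filter (fun s' : SeqOfRecord F ϑ.ν ϑ.τ9.M g p.K (k + 1) => s'.init = s), topClassWeight2At F N ϑ D g₀ os p g k θ δ' t s' =
      classWeightOfDatum₉ F N ϑ D g₀ os p g k t s := by
  classical
  have hk' : k < p.K := by omega
  have hlow := chiSeqOfRecordAt_topLetter_of_lt F N ϑ p g k hk' θ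
  have htop : topLetter ϑ.ν θ p g (k + 1) = θ := by rw [hk]; exact topLetter_top ϑ.ν θ p g
  set T : SeqOfRecord F ϑ.ν ϑ.τ9.M g p.K k → GaugeField (F.P p.K) k (SU N) → ℝ :=
    fun s₀ U => if s₀ = s then dressedSlotsOfDatum₉ F N ϑ D g₀ os t p g k s₀ U else 0 with hT
  have hintT : ∀ s₀ : SeqOfRecord F ϑ.ν ϑ.τ9.M g p.K k,
      Integrable (fun U => chiSeqOfRecordAt F N ϑ.ν ϑ.τ9.M g p.K k (topLetter ϑ.ν θ p g k) s₀ U * T s₀ U) (fieldMeasure (F.P p.K) k (SU N)) := by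
    intro s₀
    rw [hlow]
    by_cases h : s₀ = s
    · simp only [hT, h, if_true]; exact hint s
    · simp only [hT, h, if_false, mul_zero]; exact integrable_zero _ _ _
  have hRT := isRT_tstepOfRecordAt F N ϑ.ν ϑ.τ9.M (topLetter ϑ.ν θ) (wTop2At F N ϑ θ δ') p g k hk' T hintT
    (fun s' => measurable_wTop2At F N ϑ p g k hζm θ δ' s') (fun s' U V' => abs_wTop2At_le_one F N ϑ p g k hζ1 θ δ' s' U V')
    (fun s' => measurable_chiSeqOfRecordAt_of_localBg (localBgMeasurable F N ϑ.ν) ϑ.τ9.M g p.K (k + 1) _ s') (isStepUnity_wTop2At F N ϑ p g k hζu θ δ')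
  have h1 := hRT (fun _ => 1) measurable_const ⟨1, fun _ => by simp⟩
  simp only [mul_one, hlow, htop] at h1
  have hmask : ∀ (s' : SeqOfRecord F ϑ.ν ϑ.τ9.M g p.K (k + 1)) (V : GaugeField (F.P p.K) (k + 1) (SU N)),
      tstepOfRecordAt F N ϑ.ν ϑ.τ9.M (topLetter ϑ.ν θ) (wTop2At F N ϑ θ δ') p g k T s' V =
        if s'.init = s then topSlot2At F N ϑ D g₀ os p g k θ δ' t s' V else 0 := by
    intro s' V
    rw [hT, tstepOfRecordAt_mask]
    rfl
  have hcoarse : ∀ V : GaugeField (F.P p.K) (k + 1) (SU N),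
      ∑ s', chiSeqOfRecordAt F N ϑ.ν ϑ.τ9.M g p.K (k + 1) θ s' V * tstepOfRecordAt F N ϑ.ν ϑ.τ9.M (topLetter ϑ.ν θ) (wTop2At F N ϑ θ δ') p g k T s' V =
        ∑ s' ∈ univ.filter (fun s' : SeqOfRecord F ϑ.ν ϑ.τ9.M g p.K (k + 1) => s'.init = s),
          chiSeqOfRecordAt F N ϑ.ν ϑ.τ9.M g p.K (k + 1) θ s' V * topSlot2At F N ϑ D g₀ os p g k θ δ' t s' V := by
    intro V
    rw [Finset.sum_filter]
    refine Finset.sum_congr rfl fun s' _ => ?_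
    rw [hmask]
    split_ifs <;> simp
  have hfine : ∀ U : GaugeField (F.P p.K) k (SU N),
      ∑ s₀, chiSeqOfRecord F N ϑ.ν ϑ.τ9.M g p.K k s₀ U * T s₀ U =
        chiSeqOfRecord F N ϑ.ν ϑ.τ9.M g p.K k s U * dressedSlotsOfDatum₉ F N ϑ D g₀ os t p g k s U := by
    intro U
    rw [Finset.sum_eq_single s]
    · simp only [hT, if_true]
    · intro s₀ _ hs₀; simp only [hT, hs₀, if_false, mul_zero]
    · intro h; exact absurd (Finset.mem_univ s) h
  simp_rw [hcoarse, hfine] at h1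
  unfold topClassWeight2At classWeightOfDatum₉
  rw [← integral_finsetSum _ fun s' _ => integrable_topPiece2 F N ϑ D g₀ os p g k hk' hζm hζ1 θ θ δ' t hint s']
  exact h1

/-- ★★ **LETTER-PAIR-FREENESS OF CLASS SUMS DETERMINED BELOW THE TOP** (`k + 1 = p.K`): for a class `R` of top histories determined by their prefixes, `Σ_{s′ : R s′}
topClassWeight2^{θ,δ′}(s′)` is the same number for every letter pair. [bookkeeping] -/
theorem sum_filter_topClassWeight2At_letter_free (hk : k + 1 = p.K) (hζm : ZetaMeasurable F N ϑ.ζ) (hζ1 : IsZetaAbsLeOne F N ϑ.ν ϑ.τ9.M ϑ.ζ)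
    (hζu : IsZetaUnity F N ϑ.ν ϑ.τ9.M ϑ.ζ) (t : ℝ)
    (hint : ∀ s : SeqOfRecord F ϑ.ν ϑ.τ9.M g p.K k,
      Integrable (fun U => chiSeqOfRecord F N ϑ.ν ϑ.τ9.M g p.K k s U * dressedSlotsOfDatum₉ F N ϑ D g₀ os t p g k s U) (fieldMeasure (F.P p.K) k (SU N)))
    (R : SeqOfRecord F ϑ.ν ϑ.τ9.M g p.K (k + 1) → Prop) [DecidablePred R]
    (hR : ∀ s₁ s₂ : SeqOfRecord F ϑ.ν ϑ.τ9.M g p.K (k + 1), s₁.init = s₂.init → (R s₁ ↔ R s₂)) (θ₁ δ₁ θ₂ δ₂ : ℝ) :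
    ∑ s' ∈ univ.filter R, topClassWeight2At F N ϑ D g₀ os p g k θ₁ δ₁ t s' = ∑ s' ∈ univ.filter R, topClassWeight2At F N ϑ D g₀ os p g k θ₂ δ₂ t s' := by
  classical
  suffices h : ∀ θ δ' : ℝ, ∑ s' ∈ univ.filter R, topClassWeight2At F N ϑ D g₀ os p g k θ δ' t s' =
      ∑ s : SeqOfRecord F ϑ.ν ϑ.τ9.M g p.K k, if (∃ s' : SeqOfRecord F ϑ.ν ϑ.τ9.M g p.K (k + 1), s'.init = s ∧ R s') then
        classWeightOfDatum₉ F N ϑ D g₀ os p g k t s else 0 by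
    rw [h θ₁ δ₁, h θ₂ δ₂]
  intro θ δ'
  rw [Finset.sum_filter, Seq.sum_seq_succ_fiber]
  refine Finset.sum_congr rfl fun s _ => ?_
  by_cases hQ : ∃ s' : SeqOfRecord F ϑ.ν ϑ.τ9.M g p.K (k + 1), s'.init = s ∧ R s'
  · rw [if_pos hQ, ← sum_fiber_topClassWeight2At_eq F N ϑ D g₀ os p g k hk hζm hζ1 hζu θ δ' t hint s]
    refine Finset.sum_congr rfl fun s' hs' => ?_
    obtain ⟨s'', hs'', hR''⟩ := hQ
    have hs'i : s'.init = s := (Finset.mem_filter.1 hs').2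
    rw [if_pos ((hR s'' s' (hs''.trans hs'i.symm)).1 hR'')]
  · rw [if_neg hQ]
    refine Finset.sum_eq_zero fun s' hs' => ?_
    have hs'i : s'.init = s := (Finset.mem_filter.1 hs').2
    rw [if_neg fun h => hQ ⟨s', hs'i, h⟩]

/-- **LEVEL FORM** (`j = p.K`): for a class `R` of level-`j` histories determined by the entries strictly below `j` (asked only for `0 < j`), `Σ_{s : R s} topTerm2^{θ,δ′}_j(s)`
is the same for every letter pair. [bookkeeping] -/
theorem sum_filter_topTerm2AtLevel_letter_free (hζm : ZetaMeasurable F N ϑ.ζ) (hζ1 : IsZetaAbsLeOne F N ϑ.ν ϑ.τ9.M ϑ.ζ) (hζu : IsZetaUnity F N ϑ.ν ϑ.τ9.M ϑ.ζ) (t : ℝ)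
    (hint : ∀ k, k < p.K → ∀ s : SeqOfRecord F ϑ.ν ϑ.τ9.M g p.K k,
      Integrable (fun U => chiSeqOfRecord F N ϑ.ν ϑ.τ9.M g p.K k s U * dressedSlotsOfDatum₉ F N ϑ D g₀ os t p g k s U) (fieldMeasure (F.P p.K) k (SU N))) :
    ∀ (j : ℕ), j = p.K → ∀ (R : SeqOfRecord F ϑ.ν ϑ.τ9.M g p.K j → Prop) [DecidablePred R],
      (0 < j → ∀ s₁ s₂ : SeqOfRecord F ϑ.ν ϑ.τ9.M g p.K j, (∀ i, 1 ≤ i → i < j → s₁.Λ i = s₂.Λ i ∧ s₁.Ω i = s₂.Ω i) → (R s₁ ↔ R s₂)) →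
      ∀ θ₁ δ₁ θ₂ δ₂ : ℝ, ∑ s ∈ univ.filter R, topTerm2AtLevel F N ϑ D g₀ os p g θ₁ δ₁ t j s = ∑ s ∈ univ.filter R, topTerm2AtLevel F N ϑ D g₀ os p g θ₂ δ₂ t j s := by
  intro j hj R _ hR θ₁ δ₁ θ₂ δ₂
  cases j with
  | zero => simp only [topTerm2AtLevel_zero]
  | succ k =>
    simp only [topTerm2AtLevel_succ]
    refine sum_filter_topClassWeight2At_letter_free F N ϑ D g₀ os p g k hj hζm hζ1 hζu t (hint k (by omega)) R
      (fun s₁ s₂ h => hR (Nat.succ_pos k) s₁ s₂ ?_) θ₁ δ₁ θ₂ δ₂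
    intro i h1 hi
    have hik : i ≤ k := by omega
    exact ⟨by rw [← Seq.init_Λ s₁ h1 hik, ← Seq.init_Λ s₂ h1 hik, h], by rw [← Seq.init_Ω s₁ h1 hik, ← Seq.init_Ω s₂ h1 hik, h]⟩

end Fibre2

/-! ## §53 At the `CoPH`-keyed Stage-13 record: the bad-class sums and the totals of the doubly-gapped weights are dial-free; `RelWeightBound` too -/

section Record2

variable {F : T4Family} {N : ℕ} [NeZero N] (θ : Stage13HParams F N) (hP : θ.Provisos₁₃CoPH F N) (K₀ : ℕ) (g₀ : ℕ → ℝ) (os : List (ULoop F)) (jcut : ℕ → ℕ)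

/-- run A: the sum of the doubly-gapped weights over ANY finite key set is the sum of the pair-lettered top terms over the histories keyed into it (fibre sums along `keyA₁₃`;
the filter read with the reading's own classical key decidability). [bookkeeping] -/
theorem sum_keys_gapWeight2A₁₃_eq_sum_filter (K : ℕ) (S : Finset (Σ K, SiteSeqKey F (K₀ + K))) (ρ ρ' : ℕ → ℝ) (n₁ n₂ : ℕ → ℕ) (t : ℝ) :
    ∑ x ∈ S, gapWeight2A₁₃ θ hP K₀ g₀ os ρ ρ' n₁ n₂ K t x =
      letI : ∀ Kc, DecidableEq (SiteSeqKey F Kc) := fun _ => Classical.decEq _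
      ∑ s ∈ univ.filter (fun s => keyA₁₃ θ K₀ g₀ K s ∈ S),
        topTerm2AtLevel F N θ.toStage9Params (datumOfRecord₁₃CoPH F N θ hP) g₀ os (runA₁₃ F K₀ g₀ K) (histA₁₃ θ K₀ g₀ K)
          (cutGrid θ.ν (histA₁₃ θ K₀ g₀ K) (K₀ + K) (ρ K) (selDepthA2₁₃ θ hP K₀ g₀ os ρ (n₁ K) K t + 1))
          (bCutGrid θ.ν θ.A₁ (histA₁₃ θ K₀ g₀ K) (K₀ + K - 1) (ρ' K) (selDepthB2₁₃ θ hP K₀ g₀ os ρ' (n₂ K) K t + 1)) t (K₀ + K) s := by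
  letI : ∀ Kc, DecidableEq (SiteSeqKey F Kc) := fun _ => Classical.decEq _
  unfold gapWeight2A₁₃
  have hmaps : ∀ s ∈ univ.filter (fun s => keyA₁₃ θ K₀ g₀ K s ∈ S), keyA₁₃ θ K₀ g₀ K s ∈ S := fun s hs => (Finset.mem_filter.1 hs).2
  rw [← Finset.sum_fiberwise_of_maps_to hmaps]
  refine Finset.sum_congr rfl fun x hx => Finset.sum_congr ?_ fun _ _ => rfl
  ext s
  simp only [Finset.mem_filter, Finset.mem_univ, true_and]
  exact ⟨fun h => ⟨h ▸ hx, h⟩, fun h => h.2⟩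

/-- run B: the same along `keyB₁₃`. [bookkeeping] -/
theorem sum_keys_gapWeight2B₁₃_eq_sum_filter (K : ℕ) (S : Finset (Σ K, SiteSeqKey F (K₀ + K))) (ρ ρ' : ℕ → ℝ) (n₁ n₂ : ℕ → ℕ) (t : ℝ) :
    ∑ x ∈ S, gapWeight2B₁₃ θ hP K₀ g₀ os ρ ρ' n₁ n₂ K t x =
      letI : ∀ Kc, DecidableEq (SiteSeqKey F Kc) := fun _ => Classical.decEq _
      ∑ s' ∈ univ.filter (fun s' => keyB₁₃ θ K₀ g₀ K s' ∈ S),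
        topTerm2AtLevel F N θ.toStage9Params (datumOfRecord₁₃CoPH F N θ hP) g₀ os (runB₁₃ F K₀ g₀ K) (histB₁₃ θ K₀ g₀ K)
          (cutGrid θ.ν (histB₁₃ θ K₀ g₀ K) (K₀ + K + 1) (ρ K) (selDepthA2₁₃ θ hP K₀ g₀ os ρ (n₁ K) K t + 1))
          (bCutGrid θ.ν θ.A₁ (histB₁₃ θ K₀ g₀ K) (K₀ + K) (ρ' K) (selDepthB2₁₃ θ hP K₀ g₀ os ρ' (n₂ K) K t + 1)) t (K₀ + K + 1) s' := by
  letI : ∀ Kc, DecidableEq (SiteSeqKey F Kc) := fun _ => Classical.decEq _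
  unfold gapWeight2B₁₃
  have hmaps : ∀ s' ∈ univ.filter (fun s' => keyB₁₃ θ K₀ g₀ K s' ∈ S), keyB₁₃ θ K₀ g₀ K s' ∈ S := fun s' hs' => (Finset.mem_filter.1 hs').2
  rw [← Finset.sum_fiberwise_of_maps_to hmaps]
  refine Finset.sum_congr rfl fun x hx => Finset.sum_congr ?_ fun _ _ => rfl
  ext s'
  simp only [Finset.mem_filter, Finset.mem_univ, true_and]
  exact ⟨fun h => ⟨h ▸ hx, h⟩, fun h => h.2⟩

/-- ★★★ **THE SUM OF RUN A's DOUBLY-GAPPED WEIGHTS OVER A KEY SET DECIDED BELOW THE TOP DOES NOT DEPEND ON THE DIALS** — for the persistence class (policy `jcut K < K₀ + K ∨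
jcut K = 0`) and for the whole class set alike: on the live line, under (H-ζ), `Σ_{x ∈ S} gapWeight2A₁₃ … ρ ρ′ n₁ n₂ K t x` is the same for every `(ρ, ρ′, n₁, n₂)` whenever
membership `keyA₁₃ … s ∈ S` is decided below the top. [bookkeeping] -/
theorem sum_keys_gapWeight2A₁₃_letter_free (E : B12.RunParams → ℝ) (hsel : θ.ppSel = ppSelLiveOfRecord F N θ.ν θ.τ9 E (wOfRecord₉ F N θ.toStage9Params))
    (hζm : ZetaMeasurable F N θ.ζ) (K : ℕ) (S : Finset (Σ K, SiteSeqKey F (K₀ + K)))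
    (hS : 0 < K₀ + K → ∀ s₁ s₂ : SeqOfRecord F θ.ν θ.τ9.M (histA₁₃ θ K₀ g₀ K) (K₀ + K) (K₀ + K),
      (∀ i, 1 ≤ i → i < K₀ + K → s₁.Λ i = s₂.Λ i ∧ s₁.Ω i = s₂.Ω i) → (keyA₁₃ θ K₀ g₀ K s₁ ∈ S ↔ keyA₁₃ θ K₀ g₀ K s₂ ∈ S))
    (ρ ρ' : ℕ → ℝ) (n₁ n₂ : ℕ → ℕ) (σ σ' : ℕ → ℝ) (m₁ m₂ : ℕ → ℕ) (t : ℝ) :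
    ∑ x ∈ S, gapWeight2A₁₃ θ hP K₀ g₀ os ρ ρ' n₁ n₂ K t x = ∑ x ∈ S, gapWeight2A₁₃ θ hP K₀ g₀ os σ σ' m₁ m₂ K t x := by
  letI : ∀ Kc, DecidableEq (SiteSeqKey F Kc) := fun _ => Classical.decEq _
  have hζ0 : ∀ p g k s Pl Ql RS U V', 0 ≤ θ.ζ p g k s Pl Ql RS U V' :=
    fun p g k s Pl Ql RS U V' => zetaOfRecord_nonneg F N θ.ν θ.τ9.M hP.zetaUnity hP.zetaAbs p g k s Pl Ql RS U V'
  have hU : LocalBgMeasurable F N θ.ν := localBgMeasurable F N θ.ν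
  have hD : (datumOfRecord₁₃CoPH F N θ hP).AvgMeasurable := (isPrintedAveraged_datumOfRecord₁₃CoPH F N θ hP).avgMeasurable
  rw [sum_keys_gapWeight2A₁₃_eq_sum_filter, sum_keys_gapWeight2A₁₃_eq_sum_filter]
  exact sum_filter_topTerm2AtLevel_letter_free F N θ.toStage9Params (datumOfRecord₁₃CoPH F N θ hP) g₀ os (runA₁₃ F K₀ g₀ K) (histA₁₃ θ K₀ g₀ K)
    hζm hP.zetaAbs hP.zetaUnity t
    (fun k _ s => integrable_chi_mul_dressedSlots_of_ppSelLive θ.toStage9Params E hsel hU hζm hζ0 hP.zetaAbs _ hD g₀ os (histA₁₃_zero θ K₀ g₀ K) t k s)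
    (K₀ + K) rfl (fun s => keyA₁₃ θ K₀ g₀ K s ∈ S) hS _ _ _ _

/-- ★★★ **… AND RUN B's** (membership decided below run B's top `K₀ + K + 1`). [bookkeeping] -/
theorem sum_keys_gapWeight2B₁₃_letter_free (E : B12.RunParams → ℝ) (hsel : θ.ppSel = ppSelLiveOfRecord F N θ.ν θ.τ9 E (wOfRecord₉ F N θ.toStage9Params))
    (hζm : ZetaMeasurable F N θ.ζ) (K : ℕ) (S : Finset (Σ K, SiteSeqKey F (K₀ + K)))
    (hS : ∀ s₁ s₂ : SeqOfRecord F θ.ν θ.τ9.M (histB₁₃ θ K₀ g₀ K) (K₀ + K + 1) (K₀ + K + 1),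
      (∀ i, 1 ≤ i → i < K₀ + K + 1 → s₁.Λ i = s₂.Λ i ∧ s₁.Ω i = s₂.Ω i) → (keyB₁₃ θ K₀ g₀ K s₁ ∈ S ↔ keyB₁₃ θ K₀ g₀ K s₂ ∈ S))
    (ρ ρ' : ℕ → ℝ) (n₁ n₂ : ℕ → ℕ) (σ σ' : ℕ → ℝ) (m₁ m₂ : ℕ → ℕ) (t : ℝ) :
    ∑ x ∈ S, gapWeight2B₁₃ θ hP K₀ g₀ os ρ ρ' n₁ n₂ K t x = ∑ x ∈ S, gapWeight2B₁₃ θ hP K₀ g₀ os σ σ' m₁ m₂ K t x := by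
  letI : ∀ Kc, DecidableEq (SiteSeqKey F Kc) := fun _ => Classical.decEq _
  have hζ0 : ∀ p g k s Pl Ql RS U V', 0 ≤ θ.ζ p g k s Pl Ql RS U V' :=
    fun p g k s Pl Ql RS U V' => zetaOfRecord_nonneg F N θ.ν θ.τ9.M hP.zetaUnity hP.zetaAbs p g k s Pl Ql RS U V'
  have hU : LocalBgMeasurable F N θ.ν := localBgMeasurable F N θ.ν
  have hD : (datumOfRecord₁₃CoPH F N θ hP).AvgMeasurable := (isPrintedAveraged_datumOfRecord₁₃CoPH F N θ hP).avgMeasurable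
  rw [sum_keys_gapWeight2B₁₃_eq_sum_filter, sum_keys_gapWeight2B₁₃_eq_sum_filter]
  exact sum_filter_topTerm2AtLevel_letter_free F N θ.toStage9Params (datumOfRecord₁₃CoPH F N θ hP) g₀ os (runB₁₃ F K₀ g₀ K) (histB₁₃ θ K₀ g₀ K)
    hζm hP.zetaAbs hP.zetaUnity t
    (fun k _ s => integrable_chi_mul_dressedSlots_of_ppSelLive θ.toStage9Params E hsel hU hζm hζ0 hP.zetaAbs _ hD g₀ os (histB₁₃_zero θ K₀ g₀ K) t k s)
    (K₀ + K + 1) rfl (fun s' => keyB₁₃ θ K₀ g₀ K s' ∈ S) (fun _ => hS) _ _ _ _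

/-- ★★★ **THE BAD-CLASS SUMS OF THE DOUBLY-GAPPED WEIGHTS ARE DIAL-FREE** (policy `jcut K < K₀ + K ∨ jcut K = 0`; live line; (H-ζ)) — both runs. [bookkeeping] -/
theorem sum_badClass₁₃_gapWeight2_letter_free (E : B12.RunParams → ℝ) (hsel : θ.ppSel = ppSelLiveOfRecord F N θ.ν θ.τ9 E (wOfRecord₉ F N θ.toStage9Params))
    (hζm : ZetaMeasurable F N θ.ζ) (K : ℕ) (hj : jcut K < K₀ + K ∨ jcut K = 0) (ρ ρ' : ℕ → ℝ) (n₁ n₂ : ℕ → ℕ) (σ σ' : ℕ → ℝ) (m₁ m₂ : ℕ → ℕ) (t : ℝ) :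
    ∑ x ∈ badClass₁₃ θ K₀ g₀ jcut K t, gapWeight2A₁₃ θ hP K₀ g₀ os ρ ρ' n₁ n₂ K t x = ∑ x ∈ badClass₁₃ θ K₀ g₀ jcut K t, gapWeight2A₁₃ θ hP K₀ g₀ os σ σ' m₁ m₂ K t x ∧
      ∑ x ∈ badClass₁₃ θ K₀ g₀ jcut K t, gapWeight2B₁₃ θ hP K₀ g₀ os ρ ρ' n₁ n₂ K t x = ∑ x ∈ badClass₁₃ θ K₀ g₀ jcut K t, gapWeight2B₁₃ θ hP K₀ g₀ os σ σ' m₁ m₂ K t x :=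
  ⟨sum_keys_gapWeight2A₁₃_letter_free θ hP K₀ g₀ os E hsel hζm K _ (fun _ s₁ s₂ h => keyA₁₃_mem_badClass₁₃_determined θ K₀ g₀ jcut K t hj s₁ s₂ h) _ _ _ _ _ _ _ _ t,
    sum_keys_gapWeight2B₁₃_letter_free θ hP K₀ g₀ os E hsel hζm K _ (fun s₁ s₂ h => keyB₁₃_mem_badClass₁₃_determined θ K₀ g₀ jcut K t hj s₁ s₂ h) _ _ _ _ _ _ _ _ t⟩

/-- ★ **THE TOTALS OF THE DOUBLY-GAPPED WEIGHTS ARE DIAL-FREE** (every key is a class: membership in the class set is constant) — both runs. [bookkeeping] -/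
theorem sum_classSet₁₃_gapWeight2_letter_free (E : B12.RunParams → ℝ) (hsel : θ.ppSel = ppSelLiveOfRecord F N θ.ν θ.τ9 E (wOfRecord₉ F N θ.toStage9Params))
    (hζm : ZetaMeasurable F N θ.ζ) (K : ℕ) (ρ ρ' : ℕ → ℝ) (n₁ n₂ : ℕ → ℕ) (σ σ' : ℕ → ℝ) (m₁ m₂ : ℕ → ℕ) (t : ℝ) :
    ∑ x ∈ classSet₁₃ θ K₀ g₀ K, gapWeight2A₁₃ θ hP K₀ g₀ os ρ ρ' n₁ n₂ K t x = ∑ x ∈ classSet₁₃ θ K₀ g₀ K, gapWeight2A₁₃ θ hP K₀ g₀ os σ σ' m₁ m₂ K t x ∧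
      ∑ x ∈ classSet₁₃ θ K₀ g₀ K, gapWeight2B₁₃ θ hP K₀ g₀ os ρ ρ' n₁ n₂ K t x = ∑ x ∈ classSet₁₃ θ K₀ g₀ K, gapWeight2B₁₃ θ hP K₀ g₀ os σ σ' m₁ m₂ K t x :=
  ⟨sum_keys_gapWeight2A₁₃_letter_free θ hP K₀ g₀ os E hsel hζm K _
      (fun _ s₁ s₂ _ => ⟨fun _ => keyA₁₃_mem_classSet₁₃ θ K₀ g₀ K s₂, fun _ => keyA₁₃_mem_classSet₁₃ θ K₀ g₀ K s₁⟩) _ _ _ _ _ _ _ _ t,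
    sum_keys_gapWeight2B₁₃_letter_free θ hP K₀ g₀ os E hsel hζm K _
      (fun s₁ s₂ _ => ⟨fun _ => keyB₁₃_mem_classSet₁₃ θ K₀ g₀ K s₂, fun _ => keyB₁₃_mem_classSet₁₃ θ K₀ g₀ K s₁⟩) _ _ _ _ _ _ _ _ t⟩

/-- ★★★ **`RelWeightBound` AT THE DOUBLY-GAPPED CARRIERS IS ONE STATEMENT FOR ALL DIALS** (policies with `jcut K < K₀ + K ∨ jcut K = 0` for every `K`; live line; (H-ζ)).
N20's face itself is NOT proved. [bookkeeping] -/
theorem relWeightBound_gap2Carriers_iff (E : B12.RunParams → ℝ) (hsel : θ.ppSel = ppSelLiveOfRecord F N θ.ν θ.τ9 E (wOfRecord₉ F N θ.toStage9Params))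
    (hζm : ZetaMeasurable F N θ.ζ) (hj : ∀ K, jcut K < K₀ + K ∨ jcut K = 0) (ρ ρ' : ℕ → ℝ) (n₁ n₂ : ℕ → ℕ) (σ σ' : ℕ → ℝ) (m₁ m₂ : ℕ → ℕ) (W : ℕ → ℝ) :
    RelWeightBound 1 (classSet₁₃ θ K₀ g₀) (gapWeight2A₁₃ θ hP K₀ g₀ os ρ ρ' n₁ n₂) (gapWeight2B₁₃ θ hP K₀ g₀ os ρ ρ' n₁ n₂) (badClass₁₃ θ K₀ g₀ jcut) W ↔
      RelWeightBound 1 (classSet₁₃ θ K₀ g₀) (gapWeight2A₁₃ θ hP K₀ g₀ os σ σ' m₁ m₂) (gapWeight2B₁₃ θ hP K₀ g₀ os σ σ' m₁ m₂) (badClass₁₃ θ K₀ g₀ jcut) W := by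
  have hb := fun K t => sum_badClass₁₃_gapWeight2_letter_free θ hP K₀ g₀ os jcut E hsel hζm K (hj K) ρ ρ' n₁ n₂ σ σ' m₁ m₂ t
  have hz := fun K t => sum_classSet₁₃_gapWeight2_letter_free θ hP K₀ g₀ os E hsel hζm K ρ ρ' n₁ n₂ σ σ' m₁ m₂ t
  constructor
  · intro h
    exact
      { bad_subset := h.bad_subset
        nonneg := h.nonneg
        lt_one := h.lt_one
        summable := h.summable
        bad_left := fun K t ht => by rw [← (hb K t).1, ← (hz K t).1]; exact h.bad_left K t ht
        bad_right := fun K t ht => by rw [← (hb K t).2, ← (hz K t).2]; exact h.bad_right K t ht }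
  · intro h
    exact
      { bad_subset := h.bad_subset
        nonneg := h.nonneg
        lt_one := h.lt_one
        summable := h.summable
        bad_left := fun K t ht => by rw [(hb K t).1, (hz K t).1]; exact h.bad_left K t ht
        bad_right := fun K t ht => by rw [(hb K t).2, (hz K t).2]; exact h.bad_right K t ht }

end Record2

end Summit.QuantumFields.YangMills.Theorems.N21ShellSplitOfRecord13CoPH

end
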